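import Summits.MatrixMultiplication.MatrixMultiplication.Theorems.FarEdgeDescentRateTransportDial
import HarnessLib

/-!
# Route `FarEdgeDescent` — the pair tower: `ω(1,k,1) − (k+1) ≤ 4·k^{−log 2/log(11/2)}` (kernel XXVI)

decomp-mm ROOT cell (D-0178), lens 2 «structural dichotomy: special vs generic», gen 50.  THESES-FREE and
definition-free (imports `Literature`, the summit `Statement` and the theses-free kernels XXIV/XXV only).
Write `e(x) = ω(1,x,1) − (x+1) ≥ 0` (`ω(1,x,1) = omegaRect K 1 x 1`, any field `K`).

THE SECOND RATE MECHANISM (cell memo NODE-g49 §«Next generation» (ii): «more than one anchor letter per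
word»).  Kernels XXIV/XXV-a propagate a certificate `bR(⟨c⟩ ⊗ ⟨A,M,A⟩) ≤ Λ·cAM` through
(crude CW82 augmentation `q = (Λ−1)cAM` → the words of the `N`-th power with exactly ONE block letter
`⟨A,M,A⟩` → Kronecker SQUARE, needed to grow `A`).  Here the class is the words with exactly TWO block
letters: `C(N,2)·c²` words, each `≅ ⟨A², M²q^{N−2}, A²⟩` — the base SQUARES BY ITSELF, no Kronecker square,
and the format exponent grows only by the factor `N/2` per stage instead of `N`.  Fixed point:
`(Λ+1)^N ≤ Λ·C(N,2)·(Λ−1)^{N−2}`; with `N = 11`, `Λ = 20`: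
`21^11 = 350277500542221 ≤ 20·55·19^9 = 354956467556900` (`pair_step`).  Tower (`pair_tower`): base
`bR(⟨1⟩ ⊗ ⟨20,1,20⟩) ≤ 400`, stage `s` has `A = 20^{2^s}`, invariants `55c ≤ A²`, `M·A⁴ ≤ 20^{4·11^s}`, so
`log M/log A ≤ 4·(11/2)^s − 4` while `log Λ/log A = 2^{−s}`: `e(k) ≤ 2^{−s}` for real `k ≥ 4·(11/2)^s − 4`
(`excess_le_inv_two_pow_pair`), hence AT THE ORDER `δ₂ = log 2/log(11/2) = 0.40659…` (`(11/2)^{δ₂} = 2`)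
`e(k) ≤ 4·k^{−δ₂}` for every REAL `k ≥ 1` (`excess_le_four_mul_rpow_pairOrder`; the constant is
`2·4^{δ₂} = 3.514… ≤ 4`), the clean rational rung `e(k) ≤ 4·k^{−2/5}` (`excess_le_four_mul_rpow_two_fifths`),
`RateBeyond θ` for every `θ < δ₂` (`rateBeyond_of_lt_pairOrder`, the item-25347 shape), and the pinned end
of the rate–transport dial of kernel XXV-b lifted from `log 2/log 11 = 0.289…` to `δ₂`
(`squareTransport_iff_of_lt_pairOrder`, `squareTransport_iff_matrixMultiplication_of_lt_pairOrder`).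
FAMILY CEILING (instrument `tower_family_scan.json`, cell memo NODE-g50): words with exactly `j` block
letters followed by a `p`-th Kronecker power reproduce the certificate iff
`(Λ+1)^{Np} ≤ Λ·C(N,j)^p·(Λ−1)^{(N−j)p}` and give order `log(jp)/log(N/j)`; over the scanned range
`j ≤ 7`, `p ≤ 3` the feasible optimum is `j = 2, p = 1, N = 11` (`Λ ∈ [18,23]` exactly), order `δ₂`;
`(j,p,N) = (1,2,11)` is kernel XXV-a (`0.289`), `(3,1,45)` gives `0.4057`, `(4,1,143)` gives `0.388`,
`(5,1,410)` gives `0.365`, `(2,2,190)` gives `0.304` (orders decrease in `j ≥ 2` and in `p`).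
NO definitions (gate rule D-0009).
[cite: CoppersmithWinograd1982, Thm. 1] [cite: KnuthTAOCP2, §4.6.4, Ex. 67(e),(g)]
[cite: LottiRomani1983, Prop. 3.3, Prop. 4.1] [cite: Blaser2013, Thm. 7.5]
-/

set_option linter.dupNamespace false

noncomputable section

open scoped BigOperators

namespace Summit.MatrixMultiplication.MatrixMultiplication.Theorems.FarEdgeDescentTowerPairs

open Literature.Computability.AlgebraicComplexity
open Literature.Barriers.MatrixMultiplication
open Summit.MatrixMultiplication.MatrixMultiplication.Theorems.FarEdgeDescentTower
open Summit.MatrixMultiplication.MatrixMultiplication.Theorems.FarEdgeDescentTowerEleven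
open Summit.MatrixMultiplication.MatrixMultiplication.Theorems.FarEdgeDescentRateTransportDial

variable (K : Type) [Field K]

/-! ## §0 Two positions out of `n + 2` -/

/-- The format of a word with block letters at two positions `p₁ < p₂` and anchor letters elsewhere:
`∏ⱼ (a at p₁,p₂; b elsewhere) = a²·bⁿ` over `Fin (n+2)`. [folklore] -/
theorem prod_ite_ite_eq {n : ℕ} (a b : ℕ) {p₁ p₂ : Fin (n + 2)} (h : p₁ < p₂) :
    ∏ j : Fin (n + 2), (if j = p₁ then a else if j = p₂ then a else b) = a ^ 2 * b ^ n := by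
  rw [Fin.prod_univ_succAbove _ p₁, if_pos rfl]
  obtain ⟨z, hz⟩ := Fin.exists_succAbove_eq (ne_of_gt h)
  have h1 : ∀ j : Fin (n + 1),
      (if p₁.succAbove j = p₁ then a else if p₁.succAbove j = p₂ then a else b) =
        if j = z then a else b := by
    intro j
    rw [if_neg (Fin.succAbove_ne p₁ j)]
    by_cases hj : j = z
    · rw [if_pos hj, if_pos (hj ▸ hz)]
    · rw [if_neg hj, if_neg]
      intro hc
      exact hj (Fin.succAbove_right_injective (hc.trans hz.symm))
  rw [Finset.prod_congr rfl fun j _ => h1 j, Fin.prod_univ_succAbove _ z, if_pos rfl,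
    Finset.prod_congr rfl fun i _ => if_neg (Fin.succAbove_ne z i), Finset.prod_const,
    Finset.card_univ, Fintype.card_fin]
  ring

/-- There are `55 = C(11,2)` pairs of positions `p₁ < p₂` in a word of length `11`. [folklore] -/
theorem card_pairs_eleven : Fintype.card {x : Fin 11 × Fin 11 // x.1 < x.2} = 55 := by decide

/-! ## §1 One stage of the pair tower (`N = 11`, `Λ = 20`) -/

/-- **The stage.**  A certificate `bR(⟨c⟩ ⊗ ⟨A,M,A⟩) ≤ 20·cAM` propagates to
`bR(⟨55c²⟩ ⊗ ⟨A², M²q⁹, A²⟩) ≤ 20·55c²·A²·M²q⁹` with `q = 19·cAM`: relabelling to `⊕_c ⟨A,M,A⟩`, the crude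
Coppersmith–Winograd augmentation (`bR(⟨1,q,1⟩ ⊕ ⊕_c⟨A,M,A⟩) ≤ 21cAM`, Knuth Ex. 4.6.4‑67(g) form,
un-pinned), the type class of the words of the 11‑th power with block letters at exactly TWO positions
`p₁ < p₂` (`55·c²` words `≅ ⟨A², M²q⁹, A²⟩`, block extraction as a restriction, Lotti–Romani Prop. 3.3 /
Bläser Thm. 7.5), and `21^11 ≤ 20·55·19^9`.  No Kronecker square.
[cite: LottiRomani1983, Prop. 3.3] [cite: KnuthTAOCP2, §4.6.4, Ex. 67(g)] [cite: Blaser2013, Thm. 7.5] -/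
theorem pair_step {c A M X q : ℕ} (hX : X = c * (A * M)) (hq : q = 19 * X)
    (h : algBorderRank (kroneckerTensor (unitTensor K c) (matMulTensor K A M A)) ≤ 20 * X) :
    algBorderRank (kroneckerTensor (unitTensor K (55 * c ^ 2))
        (matMulTensor K (A ^ 2) (M ^ 2 * q ^ 9) (A ^ 2))) ≤
      20 * (55 * c ^ 2 * (A ^ 2 * (M ^ 2 * q ^ 9))) := by
  classical
  -- (a) the direct sum of `c` blocks
  have hds : algBorderRank (matMulDirectSum K (fun _ : Fin c => A) (fun _ => M) (fun _ => A)) ≤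
      20 * X := (tensorRestrictsTo_multiple_directSum K c A M).algBorderRank_le.trans h
  -- (b) the crude augmentation by `⟨1, q, 1⟩`
  set D := matMulDirectSum K (Fin.cons 1 (fun _ : Fin c => A)) (Fin.cons q (fun _ : Fin c => M))
    (Fin.cons 1 (fun _ : Fin c => A)) with hD
  have hsumY : ∑ _i : Fin c, M * A = X := by
    rw [Finset.sum_const, Finset.card_univ, Fintype.card_fin, smul_eq_mul, hX]; ring
  have hsumX : ∑ _i : Fin c, A * M = X := by
    rw [Finset.sum_const, Finset.card_univ, Fintype.card_fin, smul_eq_mul, hX]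
  have haug : algBorderRank D ≤ 20 * X + X := by
    have h' := algBorderRank_cons_inner_le_of_le K (fun _ : Fin c => A) (fun _ => M) (fun _ => A)
      hds (q := q) (by rw [hsumY]; omega)
    rwa [hsumX] at h'
  -- (c) the words with block letters at exactly two positions `p₁ β < p₂ β`, blocks `b₁ β`, `b₂ β`
  set eP : Fin 55 ≃ {x : Fin 11 × Fin 11 // x.1 < x.2} :=
    (Fintype.equivFinOfCardEq card_pairs_eleven).symm with heP
  set e : Fin (55 * c ^ 2) ≃ Fin 55 × (Fin c × Fin c) :=
    (finCongr (by ring : 55 * c ^ 2 = 55 * (c * c))).trans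
      (finProdFinEquiv.symm.trans (Equiv.prodCongr (Equiv.refl _) finProdFinEquiv.symm)) with he
  set p₁ : Fin (55 * c ^ 2) → Fin 11 := fun β => (eP (e β).1).1.1 with hp₁
  set p₂ : Fin (55 * c ^ 2) → Fin 11 := fun β => (eP (e β).1).1.2 with hp₂
  set b₁ : Fin (55 * c ^ 2) → Fin c := fun β => (e β).2.1 with hb₁
  set b₂ : Fin (55 * c ^ 2) → Fin c := fun β => (e β).2.2 with hb₂
  have hlt : ∀ β, p₁ β < p₂ β := fun β => (eP (e β).1).2
  set rep : Fin (55 * c ^ 2) → Fin 11 → Fin (c + 1) :=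
    fun β j => if j = p₁ β then (b₁ β).succ else if j = p₂ β then (b₂ β).succ else 0 with hrep
  have hne0 : ∀ γ j, rep γ j ≠ 0 ↔ j = p₁ γ ∨ j = p₂ γ := by
    intro γ j
    simp only [hrep]
    split_ifs with h1 h2
    · simp [h1, Fin.succ_ne_zero]
    · simp [h2, Fin.succ_ne_zero]
    · simp [h1, h2]
  have hinj : Function.Injective rep := by
    intro β β' hββ'
    have h11 : p₁ β = p₁ β' ∨ p₁ β = p₂ β' :=
      (hne0 β' _).1 (hββ' ▸ (hne0 β (p₁ β)).2 (Or.inl rfl))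
    have h12 : p₂ β = p₁ β' ∨ p₂ β = p₂ β' :=
      (hne0 β' _).1 (hββ' ▸ (hne0 β (p₂ β)).2 (Or.inr rfl))
    have h21 : p₁ β' = p₁ β ∨ p₁ β' = p₂ β :=
      (hne0 β _).1 (hββ' ▸ (hne0 β' (p₁ β')).2 (Or.inl rfl))
    have hl := hlt β
    have hl' := hlt β'
    have hpos : p₁ β = p₁ β' ∧ p₂ β = p₂ β' := by
      rw [Fin.lt_def] at hl hl'
      simp only [Fin.ext_iff] at h11 h12 h21 ⊢
      omega
    have hb1 : b₁ β = b₁ β' := by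
      have h0 := congrFun hββ' (p₁ β)
      simp only [hrep, if_true] at h0
      rw [if_pos hpos.1] at h0
      exact Fin.succ_inj.1 h0
    have hb2 : b₂ β = b₂ β' := by
      have h0 := congrFun hββ' (p₂ β)
      simp only [hrep, if_true] at h0
      rw [if_neg (ne_of_gt hl), hpos.2, if_neg (ne_of_gt hl'), if_pos rfl] at h0
      exact Fin.succ_inj.1 h0
    have hP : (e β).1 = (e β').1 :=
      eP.injective (Subtype.ext (Prod.ext hpos.1 hpos.2))
    exact e.injective (Prod.ext hP (Prod.ext hb1 hb2))
  have hK : ∀ β, ∏ j, (Fin.cons 1 (fun _ : Fin c => A) : Fin (c + 1) → ℕ) (rep β j) = A ^ 2 := by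
    intro β
    have hf : (fun j => (Fin.cons 1 (fun _ : Fin c => A) : Fin (c + 1) → ℕ) (rep β j)) =
        fun j => if j = p₁ β then A else if j = p₂ β then A else 1 := funext fun j => by
      simp only [hrep]; split_ifs <;> simp
    rw [hf, prod_ite_ite_eq A 1 (hlt β)]; ring
  have hM : ∀ β, ∏ j, (Fin.cons q (fun _ : Fin c => M) : Fin (c + 1) → ℕ) (rep β j) =
      M ^ 2 * q ^ 9 := by
    intro β
    have hf : (fun j => (Fin.cons q (fun _ : Fin c => M) : Fin (c + 1) → ℕ) (rep β j)) =
        fun j => if j = p₁ β then M else if j = p₂ β then M else q := funext fun j => by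
      simp only [hrep]; split_ifs <;> simp
    rw [hf, prod_ite_ite_eq M q (hlt β)]
  have hcls : TensorRestrictsTo (kroneckerPow D 11)
      (kroneckerTensor (unitTensor K (55 * c ^ 2)) (matMulTensor K (A ^ 2) (M ^ 2 * q ^ 9) (A ^ 2))) :=
    tensorRestrictsTo_kroneckerPow_matMulDirectSum_multiple K _ _ _ rep hinj hK hM hK
  -- (d) the arithmetic of the fixed point
  calc algBorderRank (kroneckerTensor (unitTensor K (55 * c ^ 2))
          (matMulTensor K (A ^ 2) (M ^ 2 * q ^ 9) (A ^ 2)))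
        ≤ algBorderRank (kroneckerPow D 11) := hcls.algBorderRank_le
    _ ≤ algBorderRank D ^ 11 := algBorderRank_kroneckerPow_le D 11
    _ ≤ (20 * X + X) ^ 11 := Nat.pow_le_pow_left haug 11
    _ = 21 ^ 11 * X ^ 11 := by ring
    _ ≤ (20 * 55 * 19 ^ 9) * X ^ 11 := Nat.mul_le_mul_right _ (by norm_num)
    _ = 20 * (55 * c ^ 2 * (A ^ 2 * (M ^ 2 * q ^ 9))) := by rw [hq, hX]; ring

/-! ## §2 The tower and its readout -/

/-- **The pair tower.**  Stage `s`: base `A = 20^{2^s}`, multiplicity `c ≥ 1` with `55c ≤ A²`, middle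
dimension `M ≥ 1` with `M·A⁴ ≤ 20^{4·11^s}` (i.e. `log M/log A ≤ 4·(11/2)^s − 4`), certificate
`bR(⟨c⟩ ⊗ ⟨A,M,A⟩) ≤ 20·cAM`.  Base `bR(⟨1⟩ ⊗ ⟨20,1,20⟩) ≤ 400`; step = `pair_step`
(`c ↦ 55c²`, `A ↦ A²`, `M ↦ M²·(19cAM)⁹`). [cite: KnuthTAOCP2, §4.6.4, Ex. 67(g)] [cite: LottiRomani1983, Prop. 3.3] -/
theorem pair_tower (s : ℕ) : ∃ c M : ℕ, 1 ≤ c ∧ 1 ≤ M ∧ 55 * c ≤ (20 ^ 2 ^ s) ^ 2 ∧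
    M * (20 ^ 2 ^ s) ^ 4 ≤ 20 ^ (4 * 11 ^ s) ∧
    algBorderRank (kroneckerTensor (unitTensor K c) (matMulTensor K (20 ^ 2 ^ s) M (20 ^ 2 ^ s))) ≤
      20 * (c * (20 ^ 2 ^ s * M)) := by
  classical
  induction s with
  | zero =>
    refine ⟨1, 1, le_rfl, le_rfl, by norm_num, by norm_num, ?_⟩
    simp only [pow_zero, pow_one]
    have h1 : tensorRank (unitTensor K 1) ≤ 1 := by
      refine tensorRank_le_of_eq_sum (fun _ _ => (1 : K)) (fun _ _ => 1) (fun _ _ => 1) ?_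
      funext a b c
      rw [unitTensor_one, Finset.sum_apply, Finset.sum_apply, Finset.sum_apply]
      simp [triad_apply]
    calc algBorderRank (kroneckerTensor (unitTensor K 1) (matMulTensor K 20 1 20))
        ≤ algBorderRank (unitTensor K 1) * algBorderRank (matMulTensor K 20 1 20) :=
          algBorderRank_kroneckerTensor_le _ _
      _ ≤ 1 * (20 * 1 * 20) :=
          Nat.mul_le_mul ((algBorderRank_le_tensorRank _).trans h1)
            ((algBorderRank_le_tensorRank _).trans (tensorRank_matMulTensor_le K 20 1 20))
      _ = 20 * (1 * (20 * 1)) := by norm_num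
  | succ s ih =>
    obtain ⟨c, M, hc, hM, hcA, hMA, hcert⟩ := ih
    have hA20 : 20 ≤ 20 ^ 2 ^ s := Nat.le_self_pow (by positivity) 20
    rw [show 20 ^ 2 ^ (s + 1) = (20 ^ 2 ^ s) ^ 2 by rw [pow_succ, pow_mul]]
    generalize 20 ^ 2 ^ s = A at hcA hMA hcert hA20 ⊢
    have hstep := pair_step K (X := c * (A * M)) (q := 19 * (c * (A * M))) rfl rfl hcert
    have hcA' : c ≤ A ^ 2 := le_trans (Nat.le_mul_of_pos_left c (by norm_num)) hcA
    have h19c : 19 * c ≤ A * A ^ 2 := Nat.mul_le_mul (le_trans (by norm_num) hA20) hcA'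
    have hq0 : 0 < M ^ 2 * (19 * (c * (A * M))) ^ 9 := by positivity
    refine ⟨55 * c ^ 2, M ^ 2 * (19 * (c * (A * M))) ^ 9, le_trans hc ?_, hq0, ?_, ?_, hstep⟩
    · nlinarith
    · calc 55 * (55 * c ^ 2) = (55 * c) ^ 2 := by ring
        _ ≤ (A ^ 2) ^ 2 := Nat.pow_le_pow_left hcA 2
    · calc M ^ 2 * (19 * (c * (A * M))) ^ 9 * (A ^ 2) ^ 4
          = (19 * c) ^ 9 * (A ^ 17 * M ^ 11) := by ring
        _ ≤ (A * A ^ 2) ^ 9 * (A ^ 17 * M ^ 11) := Nat.mul_le_mul_right _ (Nat.pow_le_pow_left h19c 9)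
        _ = (M * A ^ 4) ^ 11 := by ring
        _ ≤ (20 ^ (4 * 11 ^ s)) ^ 11 := Nat.pow_le_pow_left hMA 11
        _ = 20 ^ (4 * 11 ^ (s + 1)) := by rw [← pow_mul, pow_succ]; ring_nf

/-- **`e(k) ≤ 2^{−s}` for every real `k ≥ 4·(11/2)^s − 4`** (readout of stage `s` of the pair tower with the
general-ratio readout of kernel XXV-a: `log M_s/log A_s ≤ 4·(11/2)^s − 4` and `log 20/log A_s = 2^{−s}`),
every field. [cite: LottiRomani1983, Prop. 4.1] -/
theorem excess_le_inv_two_pow_pair (s : ℕ) {k : ℝ} (hk : 4 * (11 / 2 : ℝ) ^ s - 4 ≤ k) :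
    omegaRect K 1 k 1 - (k + 1) ≤ 1 / (2 : ℝ) ^ s := by
  obtain ⟨c, M, hc, hM, -, hMA, hcert⟩ := pair_tower K s
  have hA2 : 2 ≤ 20 ^ 2 ^ s := le_trans (by norm_num) (Nat.le_self_pow (by positivity) 20)
  have hlog : Real.log ((20 ^ 2 ^ s : ℕ) : ℝ) = (2 : ℝ) ^ s * Real.log 20 := by
    push_cast
    rw [Real.log_pow]; push_cast; ring
  generalize 20 ^ 2 ^ s = A at hA2 hlog hMA hcert
  have hA0 : (0 : ℝ) < A := by exact_mod_cast (by omega : 0 < A)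
  have hlA : 0 < Real.log (A : ℝ) := Real.log_pos (by exact_mod_cast (by omega : 1 < A))
  have hM0 : (0 : ℝ) < M := by exact_mod_cast (by omega : 0 < M)
  have hl20 : 0 < Real.log 20 := Real.log_pos (by norm_num)
  have h112 : (11 / 2 : ℝ) ^ s * (2 : ℝ) ^ s = (11 : ℝ) ^ s := by
    rw [← mul_pow]; norm_num
  have hthr : Real.log M / Real.log (A : ℝ) ≤ 4 * (11 / 2 : ℝ) ^ s - 4 := by
    rw [div_le_iff₀ hlA]
    have h' : (M : ℝ) * (A : ℝ) ^ 4 ≤ (20 : ℝ) ^ (4 * 11 ^ s) := by exact_mod_cast hMA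
    have h'' := Real.log_le_log (by positivity) h'
    rw [Real.log_mul hM0.ne' (by positivity), Real.log_pow, Real.log_pow] at h''
    push_cast at h''
    rw [hlog]
    have h3 : (4 * (11 / 2 : ℝ) ^ s - 4) * ((2 : ℝ) ^ s * Real.log 20) =
        4 * 11 ^ s * Real.log 20 - 4 * ((2 : ℝ) ^ s * Real.log 20) := by
      rw [← h112]; ring
    rw [h3]
    rw [hlog] at h''
    linarith
  have h := excess_le_of_cert_ratio K (Λ := 20) (by norm_num) hc hA2 hM rfl hcert (hthr.trans hk)
  rw [hlog] at h
  calc omegaRect K 1 k 1 - (k + 1) ≤ Real.log 20 / ((2 : ℝ) ^ s * Real.log 20) := h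
    _ = 1 / (2 : ℝ) ^ s := by field_simp

/-! ## §3 The rate at the order `log 2 / log (11/2)`, for every real `k ≥ 1` -/

/-- **`e(k) ≤ 4·k^{−δ₂}` for every REAL `k ≥ 1`, `δ₂ = log 2/log(11/2)`** (`= 0.40659…`), every field:
with `t = (k+4)/4` and `s = ⌊log_{11/2} t⌋`, stage `s` applies (`4·(11/2)^s − 4 ≤ k`) and
`2^{−s} = 2·((11/2)^{s+1})^{−δ₂} ≤ 2·t^{−δ₂} ≤ 2·4^{δ₂}·k^{−δ₂} ≤ 4·k^{−δ₂}` (`(11/2)^{δ₂} = 2`,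
`4^{δ₂} ≤ 2` as `δ₂ ≤ 1/2`).  The order of the pair tower; supersedes kernel XXV-a's `log 2/log 11 = 0.289…`.
[cite: LottiRomani1983, Prop. 4.1] [cite: CoppersmithWinograd1982, Thm. 1] -/
theorem excess_le_four_mul_rpow_pairOrder {k : ℝ} (hk : 1 ≤ k) :
    omegaRect K 1 k 1 - (k + 1) ≤
      4 * k ^ (-(Real.log 2 / Real.log (11 / 2))) := by
  set b : ℝ := 11 / 2 with hb
  set δ : ℝ := Real.log 2 / Real.log b with hδ
  have hb1 : 1 < b := by norm_num
  have hb0 : 0 < b := by norm_num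
  have hk0 : 0 < k := by linarith
  set t : ℝ := (k + 4) / 4 with ht
  have ht1 : 1 ≤ t := by rw [ht]; linarith
  have ht0 : 0 < t := by linarith
  set s : ℕ := ⌊Real.logb b t⌋₊ with hs
  have hlogb0 : 0 ≤ Real.logb b t := Real.logb_nonneg hb1 ht1
  have hs1 : (s : ℝ) ≤ Real.logb b t := Nat.floor_le hlogb0
  have hs2 : Real.logb b t < (s : ℝ) + 1 := Nat.lt_floor_add_one _
  have hbs : b ^ s ≤ t := by
    have := (Real.le_logb_iff_rpow_le hb1 ht0).1 hs1
    rwa [Real.rpow_natCast] at this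
  have hbs' : t < b ^ (s + 1) := by
    have := (Real.logb_lt_iff_lt_rpow hb1 ht0).1 hs2
    rwa [show ((s : ℝ) + 1) = ((s + 1 : ℕ) : ℝ) by push_cast; ring, Real.rpow_natCast] at this
  -- stage `s` applies
  have he := excess_le_inv_two_pow_pair K s (k := k) (by rw [← hb]; rw [ht] at hbs; linarith)
  have hl2 : 0 < Real.log 2 := Real.log_pos (by norm_num)
  have hlb : 0 < Real.log b := Real.log_pos hb1
  have hδ0 : 0 < δ := div_pos hl2 hlb
  -- `b^δ = 2`, hence `2^(s+1) = (b^(s+1))^δ`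
  have hbδ : b ^ δ = 2 := by
    rw [Real.rpow_def_of_pos hb0, hδ, mul_div_cancel₀ _ hlb.ne', Real.exp_log (by norm_num : (0 : ℝ) < 2)]
  have h2s : (2 : ℝ) ^ (s + 1) = (b ^ (s + 1)) ^ δ := by
    rw [← hbδ, ← Real.rpow_natCast (b ^ δ) (s + 1), ← Real.rpow_mul hb0.le δ ((s + 1 : ℕ) : ℝ),
      mul_comm, Real.rpow_natCast_mul hb0.le (s + 1) δ]
  -- `4^δ ≤ 2`
  have hδhalf : 2 * δ ≤ 1 := by
    rw [hδ, mul_div_assoc', div_le_one hlb, ← Real.log_rpow (by norm_num : (0 : ℝ) < 2)]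
    exact Real.log_le_log (by positivity) (by norm_num)
  have h4δ : (4 : ℝ) ^ δ ≤ 2 := by
    calc (4 : ℝ) ^ δ = ((2 : ℝ) ^ (2 : ℕ)) ^ δ := by norm_num
      _ = (2 : ℝ) ^ (2 * δ) := by rw [← Real.rpow_natCast_mul (by norm_num : (0 : ℝ) ≤ 2) 2 δ]; norm_num
      _ ≤ (2 : ℝ) ^ (1 : ℝ) := Real.rpow_le_rpow_of_exponent_le (by norm_num) hδhalf
      _ = 2 := Real.rpow_one 2
  have hbpow : 0 < b ^ (s + 1) := by positivity
  have hk4 : k / 4 ≤ t := by rw [ht]; linarith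
  have hk40 : 0 < k / 4 := by positivity
  calc omegaRect K 1 k 1 - (k + 1) ≤ 1 / (2 : ℝ) ^ s := he
    _ = 2 * ((2 : ℝ) ^ (s + 1))⁻¹ := by rw [pow_succ]; field_simp
    _ = 2 * (b ^ (s + 1)) ^ (-δ) := by rw [h2s, Real.rpow_neg hbpow.le]
    _ ≤ 2 * t ^ (-δ) := by
      have := Real.rpow_le_rpow_of_nonpos ht0 hbs'.le (by linarith : -δ ≤ 0)
      linarith
    _ ≤ 2 * (k / 4) ^ (-δ) := by
      have := Real.rpow_le_rpow_of_nonpos hk40 hk4 (by linarith : -δ ≤ 0)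
      linarith
    _ = 2 * (4 : ℝ) ^ δ * k ^ (-δ) := by
      rw [Real.div_rpow hk0.le (by norm_num) (-δ), Real.rpow_neg (by norm_num : (0 : ℝ) ≤ 4),
        div_inv_eq_mul]; ring
    _ ≤ 2 * 2 * k ^ (-δ) := by
      have hkδ : 0 ≤ k ^ (-δ) := Real.rpow_nonneg hk0.le _
      nlinarith
    _ = 4 * k ^ (-δ) := by norm_num

/-- **The clean rung `ω(1,k,1) − (k+1) ≤ 4·k^{−2/5}` for every real `k ≥ 1`**, every field
(`2/5 ≤ log 2/log(11/2)` as `(11/2)² ≤ 2⁵`).  Supersedes kernel XXV-a's `3·k^{−2/7}` in the exponent.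
[cite: LottiRomani1983, Prop. 4.1] -/
theorem excess_le_four_mul_rpow_two_fifths {k : ℝ} (hk : 1 ≤ k) :
    omegaRect K 1 k 1 - (k + 1) ≤ 4 * k ^ (-(2 / 5 : ℝ)) := by
  have h := excess_le_four_mul_rpow_pairOrder K hk
  have hl2 : 0 < Real.log 2 := Real.log_pos (by norm_num)
  have hlb : 0 < Real.log (11 / 2 : ℝ) := Real.log_pos (by norm_num)
  have hδ : (2 / 5 : ℝ) ≤ Real.log 2 / Real.log (11 / 2) := by
    rw [le_div_iff₀ hlb]
    have h1 : 2 * Real.log (11 / 2 : ℝ) ≤ 5 * Real.log 2 := by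
      rw [← Real.log_rpow (by norm_num : (0 : ℝ) < 11 / 2), ← Real.log_rpow (by norm_num : (0 : ℝ) < 2)]
      exact Real.log_le_log (by positivity) (by norm_num)
    linarith
  have hmono : k ^ (-(Real.log 2 / Real.log (11 / 2))) ≤ k ^ (-(2 / 5 : ℝ)) :=
    Real.rpow_le_rpow_of_exponent_le hk (by linarith)
  linarith

/-- Integer shapes, the form of the route items: `e(k) ≤ 4·k^{−δ₂}` for every integer `k ≥ 1`.
[cite: LottiRomani1983, Prop. 4.1] -/
theorem excess_le_four_mul_rpow_pairOrder_nat (k : ℕ) (hk : 1 ≤ k) :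
    omegaRect K 1 k 1 - (k + 1) ≤
      4 * (k : ℝ) ^ (-(Real.log 2 / Real.log (11 / 2))) :=
  excess_le_four_mul_rpow_pairOrder K (k := (k : ℝ)) (by exact_mod_cast hk)

/-- **The special leaf of the rate–transport dial below the pair order**: for every `θ < log 2/log(11/2)`,
`RateBeyond θ` — `∃ δ C, θ < δ ∧ ∀ k ≥ 1, e(k) ≤ C·k^{−δ}` (`δ = δ₂`, `C = 4`); the route item
`PowerAmortisation` (stmt-MatrixMultiplication-25347, `θ = 0`) shape.  Lifts kernel XXV-a's
`rateBeyond_of_lt_trueOrder` (`θ < 0.289…`) to `θ < 0.4065…`. [cite: LottiRomani1983, Prop. 4.1] -/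
theorem rateBeyond_of_lt_pairOrder {θ : ℝ} (hθ : θ < Real.log 2 / Real.log (11 / 2)) :
    ∃ δ C : ℝ, θ < δ ∧ ∀ k : ℕ, 1 ≤ k →
      omegaRect K 1 k 1 - (k + 1) ≤ C * (k : ℝ) ^ (-δ) :=
  ⟨Real.log 2 / Real.log (11 / 2), 4, hθ, fun k hk => excess_le_four_mul_rpow_pairOrder_nat K k hk⟩

/-! ## §4 The pinned end of the rate–transport dial moves to `log 2 / log (11/2)` -/

/-- **Pinned end of the dial, lifted.**  For `0 ≤ θ < log 2/log(11/2)` the generic leaf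
`SquareTransport θ` (`∀ m > 1, e(m) ≤ 2^θ·e(2m−1)`) is by itself EQUIVALENT to `ω = 2` (kernel XXV-b's
`squareTransport_iff_of_lt_trueOrder` had `θ < log 2/log 11`): the special leaf `RateBeyond θ` is now a
theorem up to the pair order. [cite: LottiRomani1983, Prop. 4.1] -/
theorem squareTransport_iff_of_lt_pairOrder {θ : ℝ} (hθ : 0 ≤ θ)
    (hθ' : θ < Real.log 2 / Real.log (11 / 2)) :
    (∀ m : ℝ, 1 < m →
        omegaRect K 1 m 1 - (m + 1) ≤ (2 : ℝ) ^ θ * (omegaRect K 1 (2 * m - 1) 1 - 2 * m)) ↔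
      omega K = 2 :=
  ⟨fun hT => omega_eq_two_of_rateBeyond_of_squareTransport K hθ (rateBeyond_of_lt_pairOrder K hθ') hT,
    fun h => ((dial_iff K hθ).1 h).2⟩

/-- The same over `ℂ`, against the summit statement: for `0 ≤ θ < log 2/log(11/2)`,
`SquareTransport θ ↔ MatrixMultiplication` (the costume certificate of the generic leaf moves up with
the rate). [cite: LottiRomani1983, Prop. 4.1] [cite: CoppersmithWinograd1982, Thm. 1] -/
theorem squareTransport_iff_matrixMultiplication_of_lt_pairOrder {θ : ℝ} (hθ : 0 ≤ θ)
    (hθ' : θ < Real.log 2 / Real.log (11 / 2)) :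
    (∀ m : ℝ, 1 < m →
        omegaRect ℂ 1 m 1 - (m + 1) ≤ (2 : ℝ) ^ θ * (omegaRect ℂ 1 (2 * m - 1) 1 - 2 * m)) ↔
      _root_.MatrixMultiplication := by
  rw [_root_.MatrixMultiplication_iff]
  exact squareTransport_iff_of_lt_pairOrder ℂ hθ hθ'

end Summit.MatrixMultiplication.MatrixMultiplication.Theorems.FarEdgeDescentTowerPairs

end
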